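import Summits.BirchSwinnertonDyer.BirchSwinnertonDyer.Theorems.QuadraticBranchSignedControlPlusLowerInclusionUnitRows
import Literature.NumberTheory.EllipticCurves.Kobayashi2003.SignedSelmerEtaComponentFacts
import HarnessLib

/-!
# Route `QuadraticBranchSignedControl` (rung K8, cell `bsd-potss`), crux `PlusLowerInclusionSurjBranch`
# (item stmt-BirchSwinnertonDyer-19242): the crux FROM the Eisenstein inclusion stated VERBATIM on
# Kobayashi's `η`-component object — `Char(X⁺(V/K_∞)^η) ⊆ (L_p⁺(V, η, X))` — granted the descent frame
# and two named facts (Thm. 1.2, Thm. 2.2 at `η`)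

WHAT. The crux node (E⁺) `QuadraticBranchPlusLowerInclusionAt V p` is the Eisenstein inclusion in the
cell's `ℚ(√p*)`-subtower currency (`Char X⁺(V/F_∞) ⊆ Char X⁺(V/ℚ_∞)·(Lη)`; reading flag
`Kob03-MC-eta-quadratic-subtower`). Its PRINT-CURRENCY form is the inclusion on the `η`-component
object of Kobayashi's §4: for every `D : EtaSignedSelmerDualData V κ K₀ ℚ_[p] η γ 1`, `Char(D.X) ⊆ (Lη)`
(displayed below as `hEη`; the half of "`Char(X⁺(E/K_∞)^η) = (L_p⁺(E, η, X))`", p. 8, that Kato's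
Euler system does not give — OPEN; no flag: the object is Kobayashi's own). This file proves: GRANTED
the ∀-form descent frame `hdec` (WANTED piece (i); displayed), Thm. 1.2 (NAMED fact
`Kobayashi2003.thm12_signedSelmerDual_finite_torsion`) and Thm. 2.2 at `η` (NAMED fact
`Kobayashi2003.thm22_etaSignedSelmerDual_finite_torsion`, on the Literature promotion copy of the
`η`-object, definitionally equal to the Summits original), the `η`-verbatim inclusion `hEη` IMPLIES (E⁺)
at the pair and hence the route decl `PlusLowerInclusionSurjBranch` (its tower-surjectivity antecedent
unused). Proof = the decomposition lemma `exists_etaDatum_prod_linearEquiv_of_decomposition`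
(p420208): `Char DF = Char D · Char Dη ⊆ Char D · (Lη)` (`Ideal.mul_mono_right`). Together with the
converse direction (k8q-c3's transport pattern) the crux can be RE-TYPED VERBATIM on Kobayashi's object
once piece (i) lands — the same move as the planner's `PublishedInputKO13` re-typing (K8 rev 7).

HONEST FRAMING (cell `bsd-potss`, run/shared/lean/pub/bsd-potss/; FULL-BSD rank ≤ 1 programme): TOOL
THEOREMS ONLY — no definition, no named fact minted, no `sorry`, axioms standard. CONDITIONAL on the
displayed frame `hdec`, the displayed OPEN inclusion `hEη` (a conjecture-strength statement in
hypothesis position — it IS the crux in print currency, not an input smuggled as known) and two named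
facts; the crux / item / route are NOT closed; nothing is booked; `BSD(W, p)` is claimed for no pair;
this is not "finishing BSD". Seat `bsd-potss-k8q-c2` (prover), g0; `--supports stmt-BirchSwinnertonDyer-19242`.

References: [Kobayashi2003] Thm. 1.2 (p. 2), Thm. 2.2 (p. 5), §4 Even main conjecture (p. 8), §3
(p. 5); [GreenbergLNM1716] §1 (p. 60), §3; [Washington1997] §13.2.
-/

set_option autoImplicit false
set_option linter.dupNamespace false

noncomputable section

open scoped Classical

open CongruenceSubgroup Field WeierstrassCurve
open Literature.NumberTheory.EllipticCurves
open Literature.NumberTheory.EllipticCurves.ModularForms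
open Literature.NumberTheory.GaloisRepresentations
open Summit.BirchSwinnertonDyer.Rank1Residual.Additive
open Summit.BirchSwinnertonDyer.Rank1Residual.Additive.SignedTwist
open Summit.BirchSwinnertonDyer.BirchSwinnertonDyer.Theses.QuadraticBranchSignedControl

namespace Summit.BirchSwinnertonDyer.BirchSwinnertonDyer.Theorems

/-- **(E⁺) AT A PAIR from the Eisenstein inclusion stated VERBATIM on the `η`-component object,
granted the frame, Thm. 1.2 and Thm. 2.2 at `η`** (abstract cyclotomic model `K₀`). `hEη`: for every
generator `γ ∈ Gal(ℚ̄/K₀)` matching the variable and every `D : EtaSignedSelmerDualData V κ K₀ ℚ_[p] ηq γ 1`,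
`Char(D.X) ⊆ (Lη)` for every branch function `Lη` — the lower half of Kobayashi's even main [C] at `η`
(p. 8), OPEN, displayed; `hdec`: the ∀-form descent frame (WANTED; displayed); `h12`, `h22`: NAMED facts
(Thm. 1.2; Thm. 2.2 at `η` on the Literature copy, reached by re-packaging the Summits datum field by
field); `hηK`: `ηq` trivial on `Gal(ℚ̄/K₀)` (the frame of `h22`). Conclusion:
`QuadraticBranchPlusLowerInclusionAt V p`, by `Char DF = Char D · Char Dη ⊆ Char D · (Lη)`.
CONDITIONAL; closes nothing. [cite: Kobayashi2003, Thm. 1.2 (p. 2), Thm. 2.2 (p. 5), §4 (p. 8)]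
[cite: Washington1997, §13.2 (characteristic ideals over Λ)] -/
theorem quadraticBranchPlusLowerInclusionAt_of_etaLowerInclusion_of_decomposition
    {V : WeierstrassCurve ℚ} [V.IsElliptic] [V.IsGloballyMinimal] {p : ℕ} [Fact p.Prime]
    (h12 : Kobayashi2003.thm12_signedSelmerDual_finite_torsion)
    (h22 : Kobayashi2003.thm22_etaSignedSelmerDual_finite_torsion)
    (K₀ : Type) [Field K₀] [NumberField K₀] [IsCyclotomicExtension {p} ℚ K₀]
    [(galRange (K := ℚ) K₀).Normal] (ηq : absoluteGaloisGroup ℚ →* ℤˣ)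
    (hηK : ∀ σ ∈ galRange (K := ℚ) K₀, ηq σ = 1)
    (hdec : ∀ (κ : ZpExtension ℚ p) (γ : absoluteGaloisGroup ℚ),
        κ.IsCyclotomic → κ.IsTopGenerator γ → γ ∈ galRange (K := ℚ) K₀ →
        IsCyclotomicVariable p γ →
      ∀ (F : Type) [Field F] [NumberField F] (V' : WeierstrassCurve F) [V'.IsElliptic]
        (κF : ZpExtension F p) (γF : absoluteGaloisGroup F),
        Module.finrank ℚ F = 2 → (∃ θ : F, θ ^ 2 = algebraMap ℚ F ((-1) ^ (p / 2) * p)) →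
        (∃ C : VariableChange F, C • V.baseChange F = V') →
        κF.IsCyclotomic → κF.IsTopGenerator γF →
        (∃ ζ : ℤ_[p]ˣ, IsOfFinOrder ζ ∧
          ((GaloisRep.cyclotomicCharacter F p γF * ζ : ℤ_[p]ˣ) : ℤ_[p]) =
            (cyclotomicGenerator p : ℤ_[p])) →
      ∃ Φ : Kobayashi2003.signedSelmerInfty V' κF 1 ≃+
          Kobayashi2003.signedSelmerInfty V κ 1 × towerSignedSelmerInftyEta V κ K₀ ℚ_[p] ηq 1,
        ∀ s : Kobayashi2003.signedSelmerInfty V' κF 1,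
          ((Φ ⟨V'.conjH1 p κF.kerSubgroup γF s,
              Kobayashi2003.conjH1_mem_signedSelmerInfty V' κF 1 γF s.2⟩).1 :
              V.subgroupH1 p κ.kerSubgroup) =
            V.conjH1 p κ.kerSubgroup γ (Φ s).1 ∧
          ((Φ ⟨V'.conjH1 p κF.kerSubgroup γF s,
              Kobayashi2003.conjH1_mem_signedSelmerInfty V' κF 1 γF s.2⟩).2 :
              V.subgroupH1 p (towerTopSubgroup κ K₀)) =
            V.conjH1 p (towerTopSubgroup κ K₀) γ (Φ s).2)
    (hEη : ∀ {N : ℕ} [NeZero N] {f : CuspForm (Gamma0 N) 2},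
        p ≠ 2 → V.HasGoodReductionAtPrime p → V.frobeniusTrace p = 0 → IsNewformOf V f →
      ∀ (ϖ : ℚ), (if Even (p / 2) then (ϖ : ℝ) * V.realPeriodRat = plusPeriod f
          else (ϖ : ℝ) * V.imaginaryPeriodRat = minusPeriod f) →
      ∀ (Lη : IwasawaAlgebra p), IsQuadraticBranchPlusLFunction f p ϖ Lη →
      ∀ (κ : ZpExtension ℚ p) (γ : absoluteGaloisGroup ℚ),
        κ.IsCyclotomic → κ.IsTopGenerator γ → γ ∈ galRange (K := ℚ) K₀ →
        IsCyclotomicVariable p γ →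
      ∀ (D : EtaSignedSelmerDualData V κ K₀ ℚ_[p] ηq γ 1), D.charIdeal ≤ Ideal.span {Lη}) :
    QuadraticBranchPlusLowerInclusionAt V p := by
  intro F _ _ V' _ κ γ κF γF N _ f hp2 hgood hap hF hθ hC hκ hγ hγc hκF hγF hζ hf ϖ hϖ Lη hL D DF
  obtain ⟨γ', hγ'K, hγ', hγ'c, Dη, ⟨e⟩⟩ :=
    exists_etaDatum_prod_linearEquiv_of_decomposition K₀ ηq hdec F V' hF hθ hC hκ hγ hγc hκF hγF hζ
      D DF
  -- finiteness: Thm. 1.2 for `D`; Thm. 2.2 at `η` for `Dη` through the Literature promotion copy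
  obtain ⟨hDfin, hDtor⟩ := h12 V p hp2 hgood hap κ γ hκ hγ 1 D
  let Dη' : Literature.NumberTheory.EllipticCurves.Kobayashi2003.EtaSignedSelmerDualData
      V κ K₀ ℚ_[p] ηq γ' 1 :=
    { X := Dη.X
      conj_mem := Dη.conj_mem
      toDual := Dη.toDual
      bijective := Dη.bijective
      toDual_T_smul := Dη.toDual_T_smul
      toDual_C_smul := Dη.toDual_C_smul }
  obtain ⟨hηfin, hηtor⟩ := h22 p K₀ ηq hηK V hp2 hgood hap κ γ' hκ hγ' hγ'K 1 Dη'
  haveI : Module.Finite (IwasawaAlgebra p) D.X := hDfin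
  haveI : Module.Finite (IwasawaAlgebra p) Dη.X := hηfin
  have hPtor : Module.IsTorsion (IwasawaAlgebra p) (D.X × Dη.X) :=
    isTorsion_prod_of_isTorsion hDtor hηtor
  have hPchar : Module.charIdeal (IwasawaAlgebra p) (D.X × Dη.X) =
      Module.charIdeal (IwasawaAlgebra p) D.X * Module.charIdeal (IwasawaAlgebra p) Dη.X :=
    charIdeal_mul_of_shortExact_holds p (D.X × Dη.X) hPtor
      (LinearMap.inl (IwasawaAlgebra p) D.X Dη.X) (LinearMap.snd (IwasawaAlgebra p) D.X Dη.X)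
      LinearMap.inl_injective LinearMap.snd_surjective .inl_snd
  change Module.charIdeal (IwasawaAlgebra p) DF.X ≤
    Module.charIdeal (IwasawaAlgebra p) D.X * Ideal.span {Lη}
  rw [Module.charIdeal_eq_of_linearEquiv e, hPchar]
  exact Ideal.mul_mono_right (hEη hp2 hgood hap hf ϖ hϖ Lη hL κ γ' hκ hγ' hγ'K hγ'c Dη)

/-- **Crux `PlusLowerInclusionSurjBranch` (item 19242) FROM the Eisenstein inclusion stated VERBATIM
on Kobayashi's `η`-component object, granted the frame and two named facts** (route-level; the
conclusion is the route decl literally; its tower-surjectivity antecedent is not used). Hypotheses,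
all displayed: `h12`, `h22` (NAMED facts: Thm. 1.2; Thm. 2.2 at `η`), `hdec` (∀-form descent frame,
WANTED), `hEη` (for every `p ≥ 5`, cyclotomic `K₀`, quadratic `ηq`, good `a_p = 0` curve `V`, newform,
period ratio, branch function `Lη`, generator `γ ∈ Gal(ℚ̄/K₀)` matching the variable, and every
`η`-datum `D`: `Char(D.X) ⊆ (Lη)` — the OPEN lower half of Kobayashi's even main [C] at `η`, print
currency). `K₀ := ℚ(ζ_p)`, `η` from `exists_theta_eta_cyclotomicField`. So, once piece (i) is a
theorem, the crux can be carried VERBATIM on Kobayashi's object. CONDITIONAL; closes nothing.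
[cite: Kobayashi2003, Thm. 1.2 (p. 2), Thm. 2.2 (p. 5), §4 Even main [C] (p. 8), §3 (p. 5)]
[cite: GreenbergLNM1716, §1 (p. 60) and §3 (descent in prime-to-p extensions; reading)] -/
theorem plusLowerInclusionSurjBranch_of_etaLowerInclusion_of_decomposition
    (h12 : Kobayashi2003.thm12_signedSelmerDual_finite_torsion)
    (h22 : Kobayashi2003.thm22_etaSignedSelmerDual_finite_torsion)
    (hdec : ∀ (p : ℕ) [Fact p.Prime], 5 ≤ p →
      ∀ (K₀ : Type) [Field K₀] [NumberField K₀] [IsCyclotomicExtension {p} ℚ K₀]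
        [(galRange (K := ℚ) K₀).Normal] (ηq : absoluteGaloisGroup ℚ →* ℤˣ),
        (∀ σ ∈ galRange (K := ℚ) K₀, ηq σ = 1) → ηq ≠ 1 →
      ∀ (V : WeierstrassCurve ℚ) [V.IsElliptic] [V.IsGloballyMinimal],
        V.HasGoodReductionAtPrime p → V.frobeniusTrace p = 0 →
      ∀ (κ : ZpExtension ℚ p) (γ : absoluteGaloisGroup ℚ),
        κ.IsCyclotomic → κ.IsTopGenerator γ → γ ∈ galRange (K := ℚ) K₀ →
        IsCyclotomicVariable p γ →
      ∀ (F : Type) [Field F] [NumberField F] (V' : WeierstrassCurve F) [V'.IsElliptic]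
        (κF : ZpExtension F p) (γF : absoluteGaloisGroup F),
        Module.finrank ℚ F = 2 → (∃ θ : F, θ ^ 2 = algebraMap ℚ F ((-1) ^ (p / 2) * p)) →
        (∃ C : VariableChange F, C • V.baseChange F = V') →
        κF.IsCyclotomic → κF.IsTopGenerator γF →
        (∃ ζ : ℤ_[p]ˣ, IsOfFinOrder ζ ∧
          ((GaloisRep.cyclotomicCharacter F p γF * ζ : ℤ_[p]ˣ) : ℤ_[p]) =
            (cyclotomicGenerator p : ℤ_[p])) →
      ∃ Φ : Kobayashi2003.signedSelmerInfty V' κF 1 ≃+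
          Kobayashi2003.signedSelmerInfty V κ 1 × towerSignedSelmerInftyEta V κ K₀ ℚ_[p] ηq 1,
        ∀ s : Kobayashi2003.signedSelmerInfty V' κF 1,
          ((Φ ⟨V'.conjH1 p κF.kerSubgroup γF s,
              Kobayashi2003.conjH1_mem_signedSelmerInfty V' κF 1 γF s.2⟩).1 :
              V.subgroupH1 p κ.kerSubgroup) =
            V.conjH1 p κ.kerSubgroup γ (Φ s).1 ∧
          ((Φ ⟨V'.conjH1 p κF.kerSubgroup γF s,
              Kobayashi2003.conjH1_mem_signedSelmerInfty V' κF 1 γF s.2⟩).2 :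
              V.subgroupH1 p (towerTopSubgroup κ K₀)) =
            V.conjH1 p (towerTopSubgroup κ K₀) γ (Φ s).2)
    (hEη : ∀ (p : ℕ) [Fact p.Prime], 5 ≤ p →
      ∀ (K₀ : Type) [Field K₀] [NumberField K₀] [IsCyclotomicExtension {p} ℚ K₀]
        [(galRange (K := ℚ) K₀).Normal] (ηq : absoluteGaloisGroup ℚ →* ℤˣ),
        (∀ σ ∈ galRange (K := ℚ) K₀, ηq σ = 1) → ηq ≠ 1 →
      ∀ (V : WeierstrassCurve ℚ) [V.IsElliptic] [V.IsGloballyMinimal] {N : ℕ} [NeZero N]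
        {f : CuspForm (Gamma0 N) 2},
        p ≠ 2 → V.HasGoodReductionAtPrime p → V.frobeniusTrace p = 0 → IsNewformOf V f →
      ∀ (ϖ : ℚ), (if Even (p / 2) then (ϖ : ℝ) * V.realPeriodRat = plusPeriod f
          else (ϖ : ℝ) * V.imaginaryPeriodRat = minusPeriod f) →
      ∀ (Lη : IwasawaAlgebra p), IsQuadraticBranchPlusLFunction f p ϖ Lη →
      ∀ (κ : ZpExtension ℚ p) (γ : absoluteGaloisGroup ℚ),
        κ.IsCyclotomic → κ.IsTopGenerator γ → γ ∈ galRange (K := ℚ) K₀ →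
        IsCyclotomicVariable p γ →
      ∀ (D : EtaSignedSelmerDualData V κ K₀ ℚ_[p] ηq γ 1), D.charIdeal ≤ Ideal.span {Lη}) :
    PlusLowerInclusionSurjBranch := by
  intro V _ _ p _ hp5 hgood hap _
  have hp2 : p ≠ 2 := by omega
  haveI : NeZero p := ⟨(Fact.out : p.Prime).ne_zero⟩
  haveI : IsCyclotomicExtension {p} ℚ (CyclotomicField p ℚ) :=
    CyclotomicField.isCyclotomicExtension p ℚ
  haveI : (galRange (K := ℚ) (CyclotomicField p ℚ)).Normal := normal_galRange_cyclotomic p _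
  obtain ⟨θ, ηq, -, -, -, hηK, hη1⟩ := exists_theta_eta_cyclotomicField p hp2
  exact quadraticBranchPlusLowerInclusionAt_of_etaLowerInclusion_of_decomposition h12 h22
    (CyclotomicField p ℚ) ηq hηK
    (fun κ γ hκ hγ hγK hγc F _ _ V' _ κF γF hF hθ hC hκF hγF hζ =>
      hdec p hp5 (CyclotomicField p ℚ) ηq hηK hη1 V hgood hap κ γ hκ hγ hγK hγc F V' κF γF hF hθ hC
        hκF hγF hζ)
    (fun hp2' hgood' hap' hf ϖ hϖ Lη hL κ γ hκ hγ hγK hγc Dη =>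
      hEη p hp5 (CyclotomicField p ℚ) ηq hηK hη1 V hp2' hgood' hap' hf ϖ hϖ Lη hL κ γ hκ hγ hγK
        hγc Dη)

end Summit.BirchSwinnertonDyer.BirchSwinnertonDyer.Theorems

end
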